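import Literature.Geometry.DiscreteGeometry.TwoShellPatterns
import Literature.MathematicalPhysics.StatisticalMechanics.Crystallization

/-!
# Crux `FarFieldGapR` (stmt-AtomisticToContinuum-14969), line `Sketch`: octahedral-hole facts

Route `PhononSlackCertificates`, support file for the line skeleton
`PhononSlackCertificatesFarFieldGapR` (stub `stub_hole`).  Pure pattern arithmetic about the two
two-shell patterns `fccTwoShellPattern = scaledPattern (fccInt ∪ fccSecondShellInt) 2` and
`hcpTwoShellPattern = scaledPattern (hcpInt ∪ hcpSecondShellInt) 18` of
`Literature.Geometry.DiscreteGeometry.TwoShellPatterns` (contact distance `1`).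

With `h := e₀/√2` — the centre of the octahedral hole of BOTH patterns adjacent to the central
site: the integer point `(1,0,0)/√2` of the fcc model and `(3,0,0)/√18 = (3,0,0)/(3√2)` of the hcp
model —

* every pattern point is at distance `≥ 1/√2` from `h` (the poisoning particle inserted at `h`
  keeps clearance `a/√2`): reduced, exactly as `one_le_dist_of_mem_scaledPattern`, to the integer
  facts `|v - (1,0,0)|² ≥ 1` on `fccInt ∪ fccSecondShellInt` and `|v - (3,0,0)|² ≥ 9` on
  `hcpInt ∪ hcpSecondShellInt`, both by `decide`;
* the six vertices `h ± eₘ/√2` of the octahedron around `h` are the centre `0` or pattern points: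
  they are `(e₀ ± eₘ)/√2`, i.e. the integer vectors `(2,0,0), (0,0,0), (1,±1,0), (1,0,±1)` of the
  fcc model, resp. `3·` these `= (6,0,0), (0,0,0), (3,±3,0), (3,0,±3)` of the hcp model — again a
  finite check by `decide` after the coordinate identities `hole_vertex_eq_fcc`,
  `hole_vertex_eq_hcp`.

Main statement: `stub_hole` (the registered signature of the skeleton, verbatim).
-/

noncomputable section

open scoped BigOperators

namespace Summit.AtomisticToContinuum.Crystallization.Theorems.PhononSlackCertificatesFarFieldGapR

open Literature.MathematicalPhysics.StatisticalMechanics Literature.Geometry.DiscreteGeometry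

/-! ## Integer facts (by `decide`) -/

/-- Every vector of the fcc two-shell integer model is at squared distance `≥ 1` from `(1,0,0)`.
[folklore] -/
private theorem hole_fcc_int :
    ∀ v ∈ fccInt ∪ fccSecondShellInt, ((1 : ℕ) : ℤ) ≤ sqNormInt (v - ![1, 0, 0]) := by
  decide

/-- Every vector of the hcp two-shell integer model is at squared distance `≥ 9` from `(3,0,0)`.
[folklore] -/
private theorem hole_hcp_int :
    ∀ v ∈ hcpInt ∪ hcpSecondShellInt, ((9 : ℕ) : ℤ) ≤ sqNormInt (v - ![3, 0, 0]) := by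
  decide

/-- The six octahedron vertices `e₀ + σ eₘ` (`σ = ±1`) of the fcc integer model are `0` or
two-shell vectors: `(2,0,0), (0,0,0), (1,±1,0), (1,0,±1)`. [folklore] -/
private theorem hole_fcc_vertex_int : ∀ m : Fin 3, ∀ σ ∈ ({1, -1} : Finset ℤ),
    (fun i : Fin 3 => (if i = 0 then 1 else 0) + σ * (if i = m then 1 else 0) : Fin 3 → ℤ) = 0 ∨
    (fun i : Fin 3 => (if i = 0 then 1 else 0) + σ * (if i = m then 1 else 0) : Fin 3 → ℤ) ∈
      fccInt ∪ fccSecondShellInt := by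
  decide

/-- The six octahedron vertices `3 (e₀ + σ eₘ)` (`σ = ±1`) of the hcp integer model are `0` or
two-shell vectors: `(6,0,0), (0,0,0), (3,±3,0), (3,0,±3)`. [folklore] -/
private theorem hole_hcp_vertex_int : ∀ m : Fin 3, ∀ σ ∈ ({1, -1} : Finset ℤ),
    (fun i : Fin 3 => 3 * ((if i = 0 then 1 else 0) + σ * (if i = m then 1 else 0)) : Fin 3 → ℤ)
        = 0 ∨
    (fun i : Fin 3 => 3 * ((if i = 0 then 1 else 0) + σ * (if i = m then 1 else 0)) : Fin 3 → ℤ)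
        ∈ hcpInt ∪ hcpSecondShellInt := by
  decide

/-! ## Real arithmetic of the scales `√2` and `√18 = 3√2` -/

/-- `√18 = 3√2`. [folklore] -/
private theorem hole_sqrt_eighteen : Real.sqrt 18 = 3 * Real.sqrt 2 := by
  rw [show (18 : ℝ) = 3 ^ 2 * 2 by norm_num, Real.sqrt_mul (by norm_num) 2,
    Real.sqrt_sq (by norm_num)]

/-- `√9 = 3`. [folklore] -/
private theorem hole_sqrt_nine : Real.sqrt 9 = 3 := by
  rw [show (9 : ℝ) = 3 ^ 2 by norm_num, Real.sqrt_sq (by norm_num)]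

/-- `√9/√18 = 1/√2`. [folklore] -/
private theorem hole_coef : (Real.sqrt 18)⁻¹ * Real.sqrt 9 = (Real.sqrt 2)⁻¹ := by
  rw [hole_sqrt_eighteen, hole_sqrt_nine]
  field_simp

/-- The hole `h = e₀/√2` is the point `(1,0,0)/√2` of the fcc model. [folklore] -/
private theorem hole_intVec_fcc :
    intVec ![1, 0, 0] = EuclideanSpace.single (0 : Fin 3) (1 : ℝ) := by
  ext i; fin_cases i <;> simp

/-- The hole `h = e₀/√2` is the point `(3,0,0)/√18` of the hcp model. [folklore] -/
private theorem hole_intVec_hcp : (Real.sqrt 18)⁻¹ • intVec ![3, 0, 0] =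
    (Real.sqrt 2)⁻¹ • EuclideanSpace.single (0 : Fin 3) (1 : ℝ) := by
  ext i; fin_cases i <;> simp [hole_sqrt_eighteen]

/-- Coordinates of the octahedron vertex `h + σ eₘ/√2` in the fcc model: `(e₀ + σ eₘ)/√2`.
[folklore] -/
private theorem hole_vertex_eq_fcc (m : Fin 3) (σ : ℤ) :
    (Real.sqrt 2)⁻¹ • EuclideanSpace.single (0 : Fin 3) (1 : ℝ) +
        ((Real.sqrt 2)⁻¹ * (σ : ℝ)) • EuclideanSpace.single m (1 : ℝ) =
      (Real.sqrt 2)⁻¹ •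
        intVec (fun i : Fin 3 => (if i = 0 then 1 else 0) + σ * (if i = m then 1 else 0)) := by
  ext i
  simp only [PiLp.add_apply, PiLp.smul_apply, PiLp.single_apply, intVec_apply, smul_eq_mul]
  push_cast
  ring

/-- Coordinates of the octahedron vertex `h + σ eₘ/√2` in the hcp model: `3 (e₀ + σ eₘ)/√18`.
[folklore] -/
private theorem hole_vertex_eq_hcp (m : Fin 3) (σ : ℤ) :
    (Real.sqrt 2)⁻¹ • EuclideanSpace.single (0 : Fin 3) (1 : ℝ) +
        ((Real.sqrt 2)⁻¹ * (σ : ℝ)) • EuclideanSpace.single m (1 : ℝ) =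
      (Real.sqrt 18)⁻¹ •
        intVec (fun i : Fin 3 =>
          3 * ((if i = 0 then 1 else 0) + σ * (if i = m then 1 else 0))) := by
  ext i
  simp only [PiLp.add_apply, PiLp.smul_apply, PiLp.single_apply, intVec_apply, smul_eq_mul,
    hole_sqrt_eighteen]
  push_cast
  field_simp

/-- A sign `σ = ±1` (real) is the cast of an integer sign `τ ∈ {1, -1}`. [folklore] -/
private theorem hole_sign_cast {σ : ℝ} (hσ : σ = 1 ∨ σ = -1) :
    ∃ τ : ℤ, τ ∈ ({1, -1} : Finset ℤ) ∧ σ = (τ : ℝ) := by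
  rcases hσ with rfl | rfl
  · exact ⟨1, by simp, by simp⟩
  · exact ⟨-1, by simp, by simp⟩

/-! ## Generic facts on scaled integer patterns -/

/-- Distance from a scaled integer point: if every `v ∈ S` has `|v - c|² ≥ M`, then every point of
`scaledPattern S N` is at distance `≥ √M/√N` from `c/√N` (cf. `one_le_dist_of_mem_scaledPattern`).
[folklore] -/
private theorem hole_le_dist_of_mem_scaledPattern {S : Finset (Fin 3 → ℤ)} {N : ℕ} (hN : N ≠ 0)
    (c : Fin 3 → ℤ) (M : ℕ) (hS : ∀ v ∈ S, (M : ℤ) ≤ sqNormInt (v - c))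
    {w : EuclideanSpace ℝ (Fin 3)} (hw : w ∈ scaledPattern S N) :
    (Real.sqrt N)⁻¹ * Real.sqrt M ≤ dist w ((Real.sqrt N)⁻¹ • intVec c) := by
  obtain ⟨v, hv, rfl⟩ := Finset.mem_image.1 hw
  have hpos : (0 : ℝ) < Real.sqrt N := by positivity
  have hle : Real.sqrt M ≤ Real.sqrt (sqNormInt (v - c) : ℝ) :=
    Real.sqrt_le_sqrt (by exact_mod_cast hS v hv)
  rw [dist_eq_norm, ← smul_sub, intVec_sub, norm_smul, norm_inv, Real.norm_of_nonneg hpos.le,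
    norm_intVec]
  exact mul_le_mul_of_nonneg_left hle (inv_nonneg.mpr hpos.le)

/-- A scaled integer vector that is `0` or in `S` lies in `{0} ∪ scaledPattern S N`. [folklore] -/
private theorem hole_mem_insert {S : Finset (Fin 3 → ℤ)} {N : ℕ} {u : Fin 3 → ℤ}
    (hu : u = 0 ∨ u ∈ S) :
    (Real.sqrt N)⁻¹ • intVec u ∈ insert (0 : EuclideanSpace ℝ (Fin 3)) (scaledPattern S N) := by
  rcases hu with rfl | hu
  · have h0 : intVec 0 = 0 := by ext i; simp
    rw [h0, smul_zero]
    exact Finset.mem_insert_self _ _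
  · exact Finset.mem_insert_of_mem (Finset.mem_image_of_mem _ hu)

/-! ## The two patterns -/

/-- Every point of the fcc two-shell pattern is at distance `≥ 1/√2` from the hole `e₀/√2`.
[folklore] -/
private theorem hole_fcc_dist : ∀ w ∈ fccTwoShellPattern,
    (Real.sqrt 2)⁻¹ ≤ dist w ((Real.sqrt 2)⁻¹ • EuclideanSpace.single (0 : Fin 3) (1 : ℝ)) := by
  intro w hw
  have key := hole_le_dist_of_mem_scaledPattern two_ne_zero ![1, 0, 0] 1 hole_fcc_int hw
  simp only [Nat.cast_ofNat, Nat.cast_one, Real.sqrt_one, mul_one, hole_intVec_fcc] at key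
  exact key

/-- Every point of the hcp two-shell pattern is at distance `≥ 1/√2` from the hole `e₀/√2`.
[folklore] -/
private theorem hole_hcp_dist : ∀ w ∈ hcpTwoShellPattern,
    (Real.sqrt 2)⁻¹ ≤ dist w ((Real.sqrt 2)⁻¹ • EuclideanSpace.single (0 : Fin 3) (1 : ℝ)) := by
  intro w hw
  have key := hole_le_dist_of_mem_scaledPattern (by norm_num) ![3, 0, 0] 9 hole_hcp_int hw
  simp only [Nat.cast_ofNat, hole_coef, hole_intVec_hcp] at key
  exact key

/-- The six octahedron vertices `h ± eₘ/√2` around the hole `h = e₀/√2` are `0` or points of the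
fcc two-shell pattern. [folklore] -/
private theorem hole_fcc_vertex (m : Fin 3) (σ : ℝ) (hσ : σ = 1 ∨ σ = -1) :
    (Real.sqrt 2)⁻¹ • EuclideanSpace.single (0 : Fin 3) (1 : ℝ) +
        ((Real.sqrt 2)⁻¹ * σ) • EuclideanSpace.single m (1 : ℝ) ∈
      insert (0 : EuclideanSpace ℝ (Fin 3)) fccTwoShellPattern := by
  obtain ⟨τ, hτ, rfl⟩ := hole_sign_cast hσ
  rw [hole_vertex_eq_fcc m τ]
  have key := hole_mem_insert (N := 2) (hole_fcc_vertex_int m τ hτ)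
  simp only [Nat.cast_ofNat] at key
  exact key

/-- The six octahedron vertices `h ± eₘ/√2` around the hole `h = e₀/√2` are `0` or points of the
hcp two-shell pattern. [folklore] -/
private theorem hole_hcp_vertex (m : Fin 3) (σ : ℝ) (hσ : σ = 1 ∨ σ = -1) :
    (Real.sqrt 2)⁻¹ • EuclideanSpace.single (0 : Fin 3) (1 : ℝ) +
        ((Real.sqrt 2)⁻¹ * σ) • EuclideanSpace.single m (1 : ℝ) ∈
      insert (0 : EuclideanSpace ℝ (Fin 3)) hcpTwoShellPattern := by
  obtain ⟨τ, hτ, rfl⟩ := hole_sign_cast hσ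
  rw [hole_vertex_eq_hcp m τ]
  have key := hole_mem_insert (N := 18) (hole_hcp_vertex_int m τ hτ)
  simp only [Nat.cast_ofNat] at key
  exact key

/-! ## The registered stub -/

/-- Stub (pattern arithmetic): OCTAHEDRAL-HOLE FACTS.  With `h := e₀/√2` (the octahedral hole of
BOTH two-shell patterns adjacent to the centre; integer point `(1,0,0)/√2` of the fcc model,
`(3,0,0)/√18` of the hcp model): every pattern point is at distance `≥ 1/√2` from `h` (the centre
`0` is at distance exactly `1/√2`), and the six octahedron vertices `h ± eₘ/√2` are the centre `0`
or pattern points. [folklore] -/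
theorem stub_hole :
    ∀ P : Finset (EuclideanSpace ℝ (Fin 3)), (P = fccTwoShellPattern ∨ P = hcpTwoShellPattern) →
      (∀ w ∈ P, (Real.sqrt 2)⁻¹ ≤
        dist w ((Real.sqrt 2)⁻¹ • EuclideanSpace.single (0 : Fin 3) (1 : ℝ))) ∧
      (∀ (m : Fin 3) (σ : ℝ), (σ = 1 ∨ σ = -1) →
        (Real.sqrt 2)⁻¹ • EuclideanSpace.single (0 : Fin 3) (1 : ℝ) +
            ((Real.sqrt 2)⁻¹ * σ) • EuclideanSpace.single m (1 : ℝ) ∈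
          insert (0 : EuclideanSpace ℝ (Fin 3)) P) := by
  rintro P (rfl | rfl)
  · exact ⟨hole_fcc_dist, hole_fcc_vertex⟩
  · exact ⟨hole_hcp_dist, hole_hcp_vertex⟩

end Summit.AtomisticToContinuum.Crystallization.Theorems.PhononSlackCertificatesFarFieldGapR

end
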